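import Literature.Combinatorics.Sahi2008.Percolation
import Literature.Combinatorics.Sahi2008.PushForward
import Summits.CriticalPhenomena.PercolationContinuityZ3.Theorems.PercNearOneGluingNoHeavyLowerTailSahiCombMasterFamily
import Summits.CriticalPhenomena.PercolationContinuityZ3.Theorems.PercNearOneGluingNoHeavyLowerTailSahiSlotPatternPositivity

/-!
# The without-replacement / pattern device at every order `n` and every dimension `d` — V, SLOT-PATTERN POSITIVITY IN EVERY DIMENSION IMPLIES
# THE COMB CONJECTURE (M⁺-n): tensor-Bernstein positivity of `E_n` on product measures (this lane's `MasterFamilyCombPos n`)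

Support file of the one-cut programme (crux `NoHeavyLowerTail`, stmt-CriticalPhenomena-4575; cell `prim-masterthm`, seat P3, gen 18;
`run/shared/lean/prim/prim-masterthm/prim-masterthm-p3/HIERARCHY.md` §26; the comb hierarchy §3, §9).  Sequel of `…SahiSlotPatternPositivity`; vocabulary `SahiComb.CombPos`,
`bern`, `box`, `MasterFamilyCombPos` (`…SahiCombPositivity`, `…SahiCombMasterFamily`, P3 gen 2), `bernoulliWeight` / `DecisionTree.ind` (Literature).

* `dec`/`enc`/`cubeEquiv e : [2]^d ≃ 2^ι` along `e : ι ≃ Fin d` (`dec` monotone), `coin p e` = the axis weights `(1−p, p)`;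
  `pushWeight_gridW_coin`: the product measure `μ_p` on `2^ι` is the push-forward of the grid weight `⊗_a (1−p_{e⁻¹a}, p_{e⁻¹a})`;
  `sahiE_bernoulliWeight_eq_gridW`: `E_n(μ_p; 1_U) = E_n(gridW coin; 1_{dec⁻¹U})` (tree `sahiE_pushWeight`);
* `prof e r` (how many of the `n` slots of axis `e i` carry `1`), `slotW_coin_eq_bern`: the monomial weight of a slot family IS the tensor-Bernstein basis function
  `∏_i p_i^{j_i}(1−p_i)^{n−j_i}` of its profile;
* **`masterFamilyCombPos_of_forall_slotPatternPos : (∀ d, SlotPatternPos d n) → MasterFamilyCombPos n`** — regroup the symmetrised bridge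
  `(n!)^d·E_n = Σ_r slotW(r)·patternForm(1_U ∘ dec ∘ slot_r)` by profiles: the Bernstein coefficient of profile `j` is `(n!)^{−d} Σ_{prof r = j} patternForm(…) ≥ 0`.
With `…SahiSlotPatternThree` (`SlotPatternPos d 3 ↔ PatternPos d`) the order-3 instance is prim-sahi-p1's `masterFamilyCombPos_three_of_forall_patternPos` (there through twisted
three-partition positivity); here the implication holds at EVERY order, directly.  So the finite slot statements dominate BOTH conjecture families of the programme at order
`n`: Sahi's Conjecture 5 (`sahiConjecture_of_forall_slotPatternPos`) and (M⁺-n).  HONEST LABEL: an implication between open obligations for `n ≥ 3`; nothing is asserted.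
Everything proved; axioms standard. [this work]
-/

noncomputable section

namespace Summit.CriticalPhenomena.PercolationContinuityZ3.Theorems

open Finset Function Equiv Equiv.Perm
open Literature.Combinatorics.Sahi2008 Literature.Combinatorics.Sahi2008.CycleForm

namespace SahiSlot

/-! ### Slot-pattern positivity in every dimension ⟹ (M⁺-n): comb (tensor-Bernstein) positivity of `E_n` on product measures -/

section Comb

open SahiComb
open Literature.Probability.Percolation.BHK2006 (weight)
open Literature.Probability.Percolation.DecisionTree (ind)
open scoped Classical

variable {ι : Type} [Fintype ι] {d n : ℕ}

/-- A point of `Fin 2` other than `1` is `0` (plumbing). [folklore] -/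
private theorem fin_two_eq_zero_of_ne_one : ∀ y : Fin 2, y ≠ 1 → y = 0 := by decide

/-- In `Fin 2`, anything above `1` is `1` (plumbing). [folklore] -/
private theorem fin_two_eq_one_of_le : ∀ y y' : Fin 2, y ≤ y' → y = 1 → y' = 1 := by decide

/-- Decoding a point of the Boolean grid `[2]^d` as a configuration `ω ⊆ ι` along `e : ι ≃ Fin d`. [this work] -/
def dec (e : ι ≃ Fin d) (x : Q d 2) : Set ι := {i | x (e i) = 1}

/-- Encoding a configuration as a point of the Boolean grid. [this work] -/
def enc (e : ι ≃ Fin d) (ω : Set ι) : Q d 2 := fun a => if e.symm a ∈ ω then 1 else 0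

/-- Decoding/encoding is a bijection `[2]^d ≃ 2^ι`. [this work] -/
def cubeEquiv (e : ι ≃ Fin d) : Q d 2 ≃ Set ι where
  toFun := dec e
  invFun := enc e
  left_inv x := by
    funext a
    by_cases hx : x a = 1
    · simp [enc, dec, hx]
    · simp [enc, dec, fin_two_eq_zero_of_ne_one _ hx]
  right_inv ω := by
    ext i
    simp [dec, enc]

omit [Fintype ι] in
/-- Decoding is monotone. [this work] -/
theorem dec_mono (e : ι ≃ Fin d) : Monotone (dec e) :=
  fun _ _ hxx' _ hi => fin_two_eq_one_of_le _ _ (hxx' _) hi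

/-- The coin weights `(1−p, p)` on the two points of each axis. [this work] -/
def coin (p : ι → unitInterval) (e : ι ≃ Fin d) : Fin d → Fin 2 → ℝ := fun a y => if y = 1 then (p (e.symm a) : ℝ) else 1 - (p (e.symm a) : ℝ)

omit [Fintype ι] in
/-- Coin weights are nonnegative. [this work] -/
theorem coin_nonneg (p : ι → unitInterval) (e : ι ≃ Fin d) (a : Fin d) (y : Fin 2) : 0 ≤ coin p e a y := by
  unfold coin; split_ifs
  · exact (p _).2.1
  · exact sub_nonneg.2 (p _).2.2

omit [Fintype ι] in
/-- Coin weights sum to one. [this work] -/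
theorem sum_coin (p : ι → unitInterval) (e : ι ≃ Fin d) (a : Fin d) : ∑ y, coin p e a y = 1 := by
  rw [Fin.sum_univ_two]; simp [coin]

/-- **The product weight on `2^ι` is the push-forward of the grid weight `⊗_a (1−p,p)` on `[2]^d`.** [this work] -/
theorem pushWeight_gridW_coin (p : ι → unitInterval) (e : ι ≃ Fin d) : pushWeight (gridW (coin p e)) (cubeEquiv e) = bernoulliWeight p := by
  funext ω
  rw [pushWeight_equiv]
  change gridW (coin p e) (enc e ω) = weight (fun i => (p i : ℝ)) ω
  unfold gridW weight
  rw [← e.symm.prod_comp]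
  refine prod_congr rfl fun a _ => ?_
  by_cases h : e.symm a ∈ ω <;> simp [coin, enc, h]

/-- **`E_n` under the product measure on `2^ι`, read on the Boolean grid.** [this work] -/
theorem sahiE_bernoulliWeight_eq_gridW (p : ι → unitInterval) (e : ι ≃ Fin d) (U : Fin n → Set (Set ι)) :
    sahiE (bernoulliWeight p) n (fun j => ind (U j)) =
      sahiE (gridW (coin p e)) n (fun j => setInd (univ.filter fun x : Q d 2 => dec e x ∈ U j)) := by
  rw [← pushWeight_gridW_coin p e, sahiE_pushWeight]
  congr 1
  funext j x
  simp [ind, setInd, cubeEquiv]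

/-- The profile of a family of slot maps into `Fin 2`: how many of the `n` slots of axis `e i` carry the value `1`. [this work] -/
def prof (e : ι ≃ Fin d) (r : Fin d → Fin n → Fin 2) : ι → ℕ := fun i => (univ.filter fun m => r (e i) m = 1).card

omit [Fintype ι] in
/-- Profiles lie in the box of multidegree `(n,…,n)`. [this work] -/
theorem prof_mem_box (e : ι ≃ Fin d) (r : Fin d → Fin n → Fin 2) [Fintype ι] : prof e r ∈ box (fun _ : ι => n) := by
  rw [mem_box]
  intro i
  unfold prof
  exact (card_filter_le _ _).trans (by simp)

/-- **The monomial weight of a slot family is the tensor-Bernstein basis function of its profile.** [this work] -/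
theorem slotW_coin_eq_bern (p : ι → unitInterval) (e : ι ≃ Fin d) (r : Fin d → Fin n → Fin 2) :
    slotW (coin p e) r = bern (fun _ : ι => n) (prof e r) p := by
  unfold slotW bern
  rw [← e.prod_comp]
  refine prod_congr rfl fun i _ => ?_
  dsimp only
  have hcoin : ∀ m, coin p e (e i) (r (e i) m) = if r (e i) m = 1 then (p i : ℝ) else 1 - (p i : ℝ) := by
    intro m; simp [coin]
  simp_rw [hcoin]
  rw [prod_ite, prod_const, prod_const]
  have hc : (univ.filter fun m => ¬ r (e i) m = 1).card = n - prof e r i := by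
    have := Finset.card_filter_add_card_filter_not (s := (univ : Finset (Fin n))) (fun m => r (e i) m = 1)
    simp only [card_univ, Fintype.card_fin] at this
    unfold prof; omega
  rw [hc]
  rfl

/-- **SLOT-PATTERN POSITIVITY IN EVERY DIMENSION ⟹ (M⁺-n)**: if `SlotPatternPos d n` holds for all `d`, then for every finite `ι` and all increasing
`U_0,…,U_{n−1} ⊆ 2^ι` the map `p ↦ E_n(μ_p; 1_{U_0},…,1_{U_{n−1}})` is a NONNEGATIVE combination of the degree-`n` tensor-Bernstein basis (the comb conjecture
`MasterFamilyCombPos n` of this lane, HIERARCHY §3/§9) — the coefficient of the profile `j` is `(n!)^{-d}·Σ_{r : prof r = j} patternForm(1_U ∘ dec ∘ slot_r) ≥ 0`.  The order-3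
instance through `slotPatternPos_three_iff_patternPos` is prim-sahi-p1's `masterFamilyCombPos_three_of_forall_patternPos` (there via twisted three-partition positivity).
[this work] -/
theorem masterFamilyCombPos_of_forall_slotPatternPos (h : ∀ d, SlotPatternPos d n) : MasterFamilyCombPos n := by
  rcases Nat.eq_zero_or_pos n with rfl | hn
  · exact masterFamilyCombPos_zero
  intro ι _ U hU
  set d := Fintype.card ι
  set e : ι ≃ Fin d := Fintype.equivFin ι
  set U' : Fin n → Finset (Q d 2) := fun j => univ.filter fun x => dec e x ∈ U j with hU'
  have hU'up : ∀ j, IsUpperSet ((U' j : Finset (Q d 2)) : Set (Q d 2)) := by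
    intro j x x' hxx' hx
    rw [mem_coe] at hx ⊢
    simp only [hU', mem_filter, mem_univ, true_and] at hx ⊢
    exact hU j (dec_mono e hxx') hx
  set c : ℝ := (Fintype.card (Fin d → Perm (Fin n)) : ℝ) with hc
  have hcpos : 0 < c := by rw [hc]; exact_mod_cast Fintype.card_pos
  -- the coefficients
  refine ⟨fun j => c⁻¹ * ∑ r ∈ univ.filter (fun r : Fin d → Fin n → Fin 2 => prof e r = j),
      patternForm d n (fun i => setInd (U' i) ∘ slotMap r), fun j => ?_, fun p => ?_⟩
  · exact mul_nonneg (inv_nonneg.2 hcpos.le) (sum_nonneg fun r _ => patternForm_pullback_nonneg (h d) r U' hU'up)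
  · dsimp only
    rw [sahiE_bernoulliWeight_eq_gridW p e U]
    have hb := card_mul_sahiE_gridW_eq_sum_patternForm (coin p e) (sum_coin p e) hn (fun j => setInd (U' j))
    have hE : sahiE (gridW (coin p e)) n (fun j => setInd (U' j)) =
        c⁻¹ * ∑ r : Fin d → Fin n → Fin 2, slotW (coin p e) r * patternForm d n (fun i => setInd (U' i) ∘ slotMap r) := by
      rw [← hb, ← mul_assoc, inv_mul_cancel₀ hcpos.ne', one_mul]
    have hfib : ∑ r : Fin d → Fin n → Fin 2, slotW (coin p e) r * patternForm d n (fun i => setInd (U' i) ∘ slotMap r) =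
        ∑ j ∈ box (fun _ : ι => n), ∑ r ∈ univ.filter (fun r : Fin d → Fin n → Fin 2 => prof e r = j),
          slotW (coin p e) r * patternForm d n (fun i => setInd (U' i) ∘ slotMap r) :=
      (sum_fiberwise_of_maps_to (fun r _ => prof_mem_box e r) _).symm
    rw [hE, hfib, mul_sum]
    refine sum_congr rfl fun j _ => ?_
    rw [mul_sum, mul_sum, sum_mul]
    refine sum_congr rfl fun r hr => ?_
    rw [mem_filter] at hr
    rw [slotW_coin_eq_bern, hr.2]
    ring

end Comb

end SahiSlot

end Summit.CriticalPhenomena.PercolationContinuityZ3.Theorems
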